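import Literature.Computability.AlgebraicComplexity.MS21ANFThm35CoreAssembly
import Literature.Computability.AlgebraicComplexity.MS21MultilinearHasseLemmas
import HarnessLib

/-!
# Medini–Shpilka 2021, Thm 35 (`thm:pitRoanf`), `Δ₁ = Δ₂`, every characteristic: the Hasse branch of
# the homogeneous core

`MS21ANFThm35CoreAssembly` assembles the homogeneous core of the typed statement `MS2021_thm_35` at a
field `K` and depth `Δ` from three bricks; its separation brick `h513` (Lemma 5.13) asks for a
mixed partial `∂_i∂_j` with `∂_i∂_j ANF_Δ = 0 ≠ ∂_i∂_j ANF_Δ(My)`, which is what the printed proof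
provides in characteristic `0` / `> 2^Δ` (`MS21ANFSeparation`) but which can FAIL in small
characteristic (registry B36: in characteristic `2` no second-order DIFFERENTIAL operator separates
`ANF₁(My) = y₀² + y₀y₁ + y₂y₃` from `ANF₁`).  The characteristic-free repair (seat t18 g5's blueprint
`np/t18g5-MS21-thm35-B36-hasse-blueprint.md`, as for Thm 45 / B35) separates instead by a
second-order HASSE operator: a slot Hasse derivative `Δ²_{e_k}` (`MS2021.hasseD 2 (Pi.single k 1)`,
`MS21DiagonalTensorHasseSeparation`), which kills the multilinear `ANF_Δ` in every characteristic and
sees `y_k² · m` with coefficient `C(2,2) = 1`.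

This file (theorems only; no definitions, no new named facts, D-0026) makes the core assembly accept
that repair:

* from seat t18 g5's toolkit `MS21MultilinearHasseLemmas` (`hasseD_single_eq_zero_of_degreeOf_lt`,
  `exists_hasseD_two_eq_sum_pderiv_pderiv`): `Δ²_{e_k} ANF_Δ = 0` (`hasseD_two_single_anf`) and, for the
  MULTILINEAR `ANF_Δ`, every second Hasse derivative `Δ²_v ANF_Δ` is a second-order operator
  `Σ_{a,b} α_{ab} ∂_a∂_b ANF_Δ` — so `Δ²_{e_k}(ANF_Δ(My)) = (Δ²_{M e_k} ANF_Δ)(My) = (Σ α_{ab} ∂_a∂_b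
  ANF_Δ)(My)` is EXACTLY the input shape of the Lemma 5.14/5.15 engine `hL2D` (`hasseD_affSubst_refl`,
  chain rule upstairs);
* `dualHasseD_affSubst`: downstairs, the Hasse derivative of `P(Ax + b)` along the dual direction
  `A⁻¹ e_k` is `(Δ²_{e_k} P)(Ax + b)` (Lemma 3.8, Hasse form);
* `thm35Core_of_bricks_hasse`: the core at `(K, Δ)` from `h512` (Lemma 5.12), `hL2D` (Lemmas
  5.14+5.15) and the DISJUNCTIVE separation brick
  `h513H : mon(ANF(My)) ⊄ mon(ANF) → (∃ i j, ∂_i∂_j ANF = 0 ≠ ∂_i∂_j ANF(My)) ∨ (∃ k, Δ²_{e_k} ANF(My) ≠ 0)`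
  — the contrapositive of the blueprint's STRUCTURE LEMMA ("if every second-order Hasse operator
  killing `ANF_Δ` kills `ANF_Δ ∘ M` then `mon(ANF_Δ ∘ M) ⊆ mon(ANF_Δ)`", in flight, seat t18); the Hasse
  branch peels two blocks at once (`MS2021.bind₁_ne_zero_of_forall_hasseD_two`), absorbs the inner
  `GL_{4^Δ}` (`exists_affSubst_affSubst_eq`) and calls `hL2D` with budget `2Δ+5`;
* packaging: `MS2021_thm_35_sameDepth_of_bricks_hasse` (per field) and
  `MS2021_thm_35_of_bricks_hasse : (∀K h512) → (∀K h513H) → (∀K hL2D) → MS2021_thm_35`.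

HONEST FRAMING: conditional assembly; `h512`, `h513H`, `hL2D` are NOT proved here.  `VP ≠ VNP` is NOT
proved and nothing in this file bears on it.

## References
* [MediniShpilka2021] D. Medini, A. Shpilka, CCC 2021 (LIPIcs 200:19) = arXiv:2102.05632: Thm 35 and
  its proof (§5.2, arXiv p0030:L28–p0031:L24), Lemma 5.13 (p0029:L3–L13), Lemmas 3.8–3.9, Def 3.6.
* Hasse derivatives / the characteristic-free repair: seat t18 g5,
  `MS21DiagonalTensorHasseSeparation` (registry B35/B36).
-/

noncomputable section

open MvPolynomial
open scoped Matrix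

namespace Literature.Computability.AlgebraicComplexity

namespace MS2021

/-! ### Chain rules for Hasse derivatives through `affSubst` -/

section Chain

variable {K : Type*} [Field K] {m n : ℕ}

/-- `Δ²_{e_k} ANF_Δ = 0` in every characteristic (`ANF_Δ` is multilinear, Obs 5.2).
[cite: MediniShpilka2021, Obs 5.2 (arXiv p0025:L15)] -/
theorem hasseD_two_single_anf (Δ : ℕ) (k : Fin (4 ^ Δ)) (c : K) :
    hasseD 2 (Pi.single k c) (anf K Δ) = 0 :=
  hasseD_single_eq_zero_of_degreeOf_lt 2 k c (anf K Δ) (Nat.lt_succ_of_le (degreeOf_anf_le_one K Δ k))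

/-- **Chain rule upstairs**: `Δ^k_u (q(My)) = (Δ^k_{Mu} q)(My)`.
[cite: MediniShpilka2021, Lemma 3.8 (arXiv p0017:L61-L68)] -/
theorem hasseD_affSubst_refl (M : Matrix (Fin m) (Fin m) K) (k : ℕ) (u : Fin m → K)
    (q : MvPolynomial (Fin m) K) :
    hasseD k u (affSubst le_rfl M 0 q) =
      affSubst le_rfl M 0 (hasseD k (fun j => ∑ i, M j i * u i) q) := by
  unfold affSubst
  rw [hasseD_aeval_affine _ (fun j i => M (Fin.castLE le_rfl j) i)
    (fun j => (0 : Fin m → K) (Fin.castLE le_rfl j)) (fun j => rfl) k u q]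
  rfl

/-- **Chain rule downstairs (Lemma 3.8, Hasse form)**: along the dual direction `A⁻¹ e_{w₀}` the
order-`k` Hasse derivative of `q(Ax + b)` is `(Δ^k_{e_{w₀}} q)(Ax + b)`.
[cite: MediniShpilka2021, Lemma 3.8 (arXiv p0017:L61-L68)] -/
theorem dualHasseD_affSubst (h : m ≤ n) {A : Matrix (Fin n) (Fin n) K} (hA : IsUnit A.det)
    (b : Fin n → K) (w₀ : Fin m) (k : ℕ) (q : MvPolynomial (Fin m) K) :
    hasseD k (fun j => A⁻¹ j (Fin.castLE h w₀)) (affSubst h A b q) =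
      affSubst h A b (hasseD k (Pi.single w₀ 1) q) := by
  classical
  unfold affSubst
  rw [hasseD_aeval_affine _ (fun i j => A (Fin.castLE h i) j) (fun i => b (Fin.castLE h i))
    (fun i => rfl) k]
  have hdir : (fun i : Fin m => ∑ j, A (Fin.castLE h i) j * A⁻¹ j (Fin.castLE h w₀)) =
      Pi.single w₀ 1 := by
    funext w
    rw [← Matrix.mul_apply, Matrix.mul_nonsing_inv A hA, Matrix.one_apply]
    by_cases hw : w = w₀
    · subst hw
      rw [if_pos rfl, Pi.single_eq_same]
    · rw [if_neg fun heq => hw (Fin.castLE_injective h heq), Pi.single_eq_of_ne hw]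
  rw [hdir]

end Chain

/-! ### The core at `(K, Δ)` with the disjunctive (Hasse) separation brick -/

section Core

variable {K : Type} [Field K]

/-- **The homogeneous core of MS Thm 35 at `(K, Δ)`, Hasse form of the separation brick.**  As
`thm35Core_of_bricks`, but the separation hypothesis is the DISJUNCTION
`h513H : mon(ANF(My)) ⊄ mon(ANF) → (∃ i j, ∂_i∂_j ANF = 0 ≠ ∂_i∂_j ANF(My)) ∨ (∃ k, Δ²_{e_k} ANF(My) ≠ 0)`
(contrapositive of the characteristic-free structure lemma).  In the Hasse branch:
`Δ²_{e_k}(ANF(My) - ANF) = (Σ α_{ab} ∂_a∂_b ANF)(My) ≠ 0` (multilinearity + polarisation + chain rule),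
two blocks are peeled at once (`bind₁_ne_zero_of_forall_hasseD_two`), the inner `GL_{4^Δ}` is absorbed
(`exists_affSubst_affSubst_eq`), and the Lemma 5.14/5.15 engine `hL2D` hits with budget `2Δ+5`.
[cite: MediniShpilka2021, proof of Thm 35, `Δ₁ = Δ₂` (arXiv p0030:L33–L55) and §5.2.2 (p0030:L56–p0031:L24)] -/
theorem thm35Core_of_bricks_hasse (Δ : ℕ)
    (h512 : ∀ (M : Matrix (Fin (4 ^ Δ)) (Fin (4 ^ Δ)) K), IsUnit M.det →
      (affSubst le_rfl M 0 (anf K Δ)).support ⊆ (anf K Δ).support →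
      ∃ (π : Equiv.Perm (Fin (4 ^ Δ))) (α : Fin (4 ^ Δ) → K), (∀ i, α i ≠ 0) ∧
        rename π (anf K Δ) = anf K Δ ∧
        affSubst le_rfl M 0 (anf K Δ) = aeval (fun i => C (α i) * X (π i)) (anf K Δ))
    (h513H : ∀ (M : Matrix (Fin (4 ^ Δ)) (Fin (4 ^ Δ)) K), IsUnit M.det →
      ¬ (affSubst le_rfl M 0 (anf K Δ)).support ⊆ (anf K Δ).support →
      (∃ i j, pderiv i (pderiv j (anf K Δ)) = 0 ∧
        pderiv i (pderiv j (affSubst le_rfl M 0 (anf K Δ))) ≠ 0) ∨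
      (∃ k, hasseD 2 (Pi.single k 1) (affSubst le_rfl M 0 (anf K Δ)) ≠ 0))
    (hL2D : ∀ (n t B c : ℕ) (α : Fin (4 ^ Δ) → Fin (4 ^ Δ) → K),
      (∑ a, ∑ b, C (α a b) * pderiv a (pderiv b (anf K Δ))) ≠ 0 →
      ∀ (h : 4 ^ Δ ≤ n) (A : Matrix (Fin n) (Fin n) K), IsUnit A.det → ∀ (b : Fin n → K),
      4 ^ Δ ≤ 2 ^ t → ∀ (G : Fin n → MvPolynomial (Fin B × (Fin c ⊕ Unit)) K),
      IsIndependent B G → t + 5 ≤ B →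
      bind₁ G (affSubst h A b (∑ a, ∑ b, C (α a b) * pderiv a (pderiv b (anf K Δ)))) ≠ 0) :
    ∀ (n c : ℕ) (h : 4 ^ Δ ≤ n) (A : Matrix (Fin n) (Fin n) K), IsUnit A.det →
      ∀ M : Matrix (Fin (4 ^ Δ)) (Fin (4 ^ Δ)) K, IsUnit M.det →
      affSubst le_rfl M 0 (anf K Δ) ≠ anf K Δ →
      ∀ G : Fin n → MvPolynomial (Fin (2 * max Δ Δ + 7) × (Fin c ⊕ Unit)) K,
        IsIndependent (2 * max Δ Δ + 7) G → IsUniform G →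
        bind₁ G (affSubst h A 0 (affSubst le_rfl M 0 (anf K Δ) - anf K Δ)) ≠ 0 := by
  classical
  intro n c h A hA M hM hne G hG hU
  have ht : 4 ^ Δ ≤ 2 ^ (2 * Δ) := by rw [pow_mul]; norm_num
  by_cases hsub : (affSubst le_rfl M 0 (anf K Δ)).support ⊆ (anf K Δ).support
  · -- Case (ii): same leaves up to constants — Lemma 5.12 and Lemma pitRoanfSame
    obtain ⟨π, α, hα, hπ, hform⟩ := h512 M hM hsub
    rw [aeval_scale_perm_eq π α _ hπ] at hform
    rw [hform] at hne ⊢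
    exact bind₁_affSubst_scale_anf_sub_anf_ne_zero (fun j => α (π.symm j)) (fun j => hα _) hne h hA
      0 ht G hG (by rw [max_self]; omega)
  rcases h513H M hM hsub with ⟨i, j, hij0, hijne⟩ | ⟨k, hk⟩
  · -- Case (i), mixed partial `∂_i∂_j` (the printed Lemma 5.13 branch)
    set P : MvPolynomial (Fin (4 ^ Δ)) K := affSubst le_rfl M 0 (anf K Δ) - anf K Δ with hP
    set D : MvPolynomial (Fin (4 ^ Δ)) K :=
      ∑ a, ∑ b, C (M a i * M b j) * pderiv a (pderiv b (anf K Δ)) with hD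
    have hPD : pderiv i (pderiv j P) = affSubst le_rfl M 0 D := by
      rw [hP, map_sub, map_sub, hij0, sub_zero, pderiv_pderiv_affSubst_refl]
    have hDne : D ≠ 0 := by
      intro h0
      apply hijne
      rw [pderiv_pderiv_affSubst_refl, ← hD, h0]
      simp only [affSubst, map_zero]
    have hfold : (List.ofFn ![i, j]).foldr (fun w p => pderiv w p) P = pderiv i (pderiv j P) := by
      simp [List.ofFn_succ]
    refine hit_affSubst_of_hit_pderivs h ![i, j] (2 * Δ + 5) P ?_ A 0 hA _ c G hG
      (by rw [max_self])
    intro A' b' hA' B c' H hH hB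
    rw [hfold, hPD]
    obtain ⟨A'', b'', hA'', hid⟩ := exists_affSubst_affSubst_eq h hA' b' M hM
    rw [hid]
    exact hL2D n (2 * Δ) B c' (fun a b => M a i * M b j) hDne h A'' hA'' b'' ht H hH (by omega)
  · -- Case (i), slot Hasse derivative `Δ²_{e_k}` (the characteristic-free branch)
    set P : MvPolynomial (Fin (4 ^ Δ)) K := affSubst le_rfl M 0 (anf K Δ) - anf K Δ with hP
    -- upstairs: `Δ²_{e_k}(ANF(My)) = (Δ²_{M e_k} ANF)(My) = (Σ α ∂∂ ANF)(My)`
    obtain ⟨α, hα⟩ := exists_hasseD_two_eq_sum_pderiv_pderiv (anf K Δ) (degreeOf_anf_le_one K Δ)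
      (fun j : Fin (4 ^ Δ) => ∑ i, M j i * (Pi.single k 1 : Fin (4 ^ Δ) → K) i)
    set D : MvPolynomial (Fin (4 ^ Δ)) K :=
      ∑ a, ∑ b, C (α a b) * pderiv a (pderiv b (anf K Δ)) with hD
    have hMD : hasseD 2 (Pi.single k 1) (affSubst le_rfl M 0 (anf K Δ)) = affSubst le_rfl M 0 D := by
      rw [hasseD_affSubst_refl, hα]
    have hPD : hasseD 2 (Pi.single k 1) P = affSubst le_rfl M 0 D := by
      rw [hP, hasseD_sub, hMD, hasseD_two_single_anf, sub_zero]
    have hDne : D ≠ 0 := by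
      intro h0
      apply hk
      rw [hMD, h0]
      simp only [affSubst, map_zero]
    -- downstairs: peel two blocks at once along the dual direction `A⁻¹ e_k`
    refine bind₁_ne_zero_of_forall_hasseD_two (k := 2 * max Δ Δ + 5) hG _
      (fun j => A⁻¹ j (Fin.castLE h k)) fun G'' hG'' => ?_
    rw [dualHasseD_affSubst h hA 0 k 2 P, hPD]
    obtain ⟨A'', b'', hA'', hid⟩ := exists_affSubst_affSubst_eq h hA 0 M hM
    rw [hid]
    exact hL2D n (2 * Δ) _ c α hDne h A'' hA'' b'' ht G'' hG'' (by rw [max_self])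

end Core

end MS2021

/-! ### Packaging -/

section Packaging

open MS2021

/-- **MS Thm 35 at `(K, Δ, Δ)` from Lemma 5.12, the disjunctive (Hasse) separation brick and the
Lemma 5.14/5.15 engine at `(K, Δ)`.** [cite: MediniShpilka2021, Thm 35 (CCC p.19:13; arXiv p0008:L29-30); proof §5.2 (arXiv p0030:L28–p0031:L24)] -/
theorem MS2021_thm_35_sameDepth_of_bricks_hasse (K : Type) [Field K] (Δ : ℕ)
    (h512 : ∀ (M : Matrix (Fin (4 ^ Δ)) (Fin (4 ^ Δ)) K), IsUnit M.det →
      (affSubst le_rfl M 0 (anf K Δ)).support ⊆ (anf K Δ).support →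
      ∃ (π : Equiv.Perm (Fin (4 ^ Δ))) (α : Fin (4 ^ Δ) → K), (∀ i, α i ≠ 0) ∧
        rename π (anf K Δ) = anf K Δ ∧
        affSubst le_rfl M 0 (anf K Δ) = aeval (fun i => C (α i) * X (π i)) (anf K Δ))
    (h513H : ∀ (M : Matrix (Fin (4 ^ Δ)) (Fin (4 ^ Δ)) K), IsUnit M.det →
      ¬ (affSubst le_rfl M 0 (anf K Δ)).support ⊆ (anf K Δ).support →
      (∃ i j, pderiv i (pderiv j (anf K Δ)) = 0 ∧
        pderiv i (pderiv j (affSubst le_rfl M 0 (anf K Δ))) ≠ 0) ∨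
      (∃ k, hasseD 2 (Pi.single k 1) (affSubst le_rfl M 0 (anf K Δ)) ≠ 0))
    (hL2D : ∀ (n t B c : ℕ) (α : Fin (4 ^ Δ) → Fin (4 ^ Δ) → K),
      (∑ a, ∑ b, C (α a b) * pderiv a (pderiv b (anf K Δ))) ≠ 0 →
      ∀ (h : 4 ^ Δ ≤ n) (A : Matrix (Fin n) (Fin n) K), IsUnit A.det → ∀ (b : Fin n → K),
      4 ^ Δ ≤ 2 ^ t → ∀ (G : Fin n → MvPolynomial (Fin B × (Fin c ⊕ Unit)) K),
      IsIndependent B G → t + 5 ≤ B →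
      bind₁ G (affSubst h A b (∑ a, ∑ b, C (α a b) * pderiv a (pderiv b (anf K Δ)))) ≠ 0)
    (n c : ℕ) :
    ∀ f₁ ∈ affOrbit n (anf K Δ), ∀ f₂ ∈ affOrbit n (anf K Δ), f₁ - f₂ ≠ 0 →
      ∀ G : Fin n → MvPolynomial (Fin (2 * max Δ Δ + 7) × (Fin c ⊕ Unit)) K,
        IsIndependent (2 * max Δ Δ + 7) G → IsUniform G → bind₁ G (f₁ - f₂) ≠ 0 :=
  thm35_sameDepth_of_core Δ (thm35Core_of_bricks_hasse Δ h512 h513H hL2D) n c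

/-- **MS Thm 35 (all fields, all depths) from Lemma 5.12, the disjunctive (Hasse) separation brick
and the Lemma 5.14/5.15 engine for every field and depth** — the characteristic-free assembly.
[cite: MediniShpilka2021, Thm 35 (CCC p.19:13; arXiv p0008:L29-30); proof §5.2 (arXiv p0030:L28–p0031:L24)] -/
theorem MS2021_thm_35_of_bricks_hasse
    (h512 : ∀ (K : Type) [Field K] (Δ : ℕ) (M : Matrix (Fin (4 ^ Δ)) (Fin (4 ^ Δ)) K),
      IsUnit M.det → (affSubst le_rfl M 0 (anf K Δ)).support ⊆ (anf K Δ).support →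
      ∃ (π : Equiv.Perm (Fin (4 ^ Δ))) (α : Fin (4 ^ Δ) → K), (∀ i, α i ≠ 0) ∧
        rename π (anf K Δ) = anf K Δ ∧
        affSubst le_rfl M 0 (anf K Δ) = aeval (fun i => C (α i) * X (π i)) (anf K Δ))
    (h513H : ∀ (K : Type) [Field K] (Δ : ℕ) (M : Matrix (Fin (4 ^ Δ)) (Fin (4 ^ Δ)) K),
      IsUnit M.det → ¬ (affSubst le_rfl M 0 (anf K Δ)).support ⊆ (anf K Δ).support →
      (∃ i j, pderiv i (pderiv j (anf K Δ)) = 0 ∧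
        pderiv i (pderiv j (affSubst le_rfl M 0 (anf K Δ))) ≠ 0) ∨
      (∃ k, hasseD 2 (Pi.single k 1) (affSubst le_rfl M 0 (anf K Δ)) ≠ 0))
    (hL2D : ∀ (K : Type) [Field K] (Δ n t B c : ℕ) (α : Fin (4 ^ Δ) → Fin (4 ^ Δ) → K),
      (∑ a, ∑ b, C (α a b) * pderiv a (pderiv b (anf K Δ))) ≠ 0 →
      ∀ (h : 4 ^ Δ ≤ n) (A : Matrix (Fin n) (Fin n) K), IsUnit A.det → ∀ (b : Fin n → K),
      4 ^ Δ ≤ 2 ^ t → ∀ (G : Fin n → MvPolynomial (Fin B × (Fin c ⊕ Unit)) K),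
      IsIndependent B G → t + 5 ≤ B →
      bind₁ G (affSubst h A b (∑ a, ∑ b, C (α a b) * pderiv a (pderiv b (anf K Δ)))) ≠ 0) :
    MS2021_thm_35 :=
  MS2021_thm_35_of_core fun K _ n Δ c h A hA M hM hne G hG hU =>
    thm35Core_of_bricks_hasse Δ (h512 K Δ) (h513H K Δ) (hL2D K Δ) n c h A hA M hM hne G hG hU

end Packaging


end Literature.Computability.AlgebraicComplexity

end
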